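import Literature.Analysis.FluidPDE.KNSSMildBootstrapLevel
import HarnessLib

/-!
# The difference-quotient bootstrap for bounded mild solutions, II: the upgrade `Cᵏ → Cᵏ⁺¹`,
# the differentiated mild identity, and the induction over the order

Analysis/FluidPDE proofs file (everything proved; no definitions, no named facts) on the discharge
path of `Literature.Analysis.FluidPDE.KNSS2009_mild_regularity` (`KNSSRegularityGalilean`;
Koch–Nadirashvili–Seregin–Šverák, Acta Math. 203 (2009) = arXiv:0709.3599v1, §4, Prop. 4.1 with
(4.6) and the closing bounds (4.10): for a bounded mild solution of Navier–Stokes all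
`x`-derivatives exist and are bounded on `ℝ³ × (δ, T)` by constants `C(k, δ, T, M)`). With the
level-`k` data of `KNSSMildBootstrapLevel` — (i) `Cᵏ` slices, (ii) uniform bounds, (iii) the
`k`-times differentiated mild identity
`DᵏV(τ)(x)·m = e^{(τ−s)Δ}[DᵏV(s)·m](x) − ∫ₛ^τ ∑ᵢ 𝒩_{τ−σ}[Tₖᵐ(σ)]ᵢ(x) eᵢ dσ`, (iv) measurability
of the integrand at every point — and the Lipschitz step (`lipschitz_iteratedFDeriv_of_level`),
this file closes the induction:

* `hasFDerivAt_levelDuhamel` — **dominated differentiation of the level-`k` Duhamel integral**: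
  when `DᵏV(ρ)` is `L`-Lipschitz in `x` for `ρ` in the range, each integrand
  `x ↦ ∑ᵢ 𝒩_{τ−ρ}[Tₖᵐ(ρ)]ᵢ(x)eᵢ` is smooth with `‖D(·)‖ ≤ 8829(τ−ρ)^{-1/2}(2AL + 2ᵏ⁺¹A²)∏‖mᵢ‖`
  (Lipschitz bound of the integrand from the first-difference calculus of part I), the derivative
  `ρ ↦ D(…)(x₀)` is measurable because it is a limit of difference quotients of the measurable
  point evaluations (`aestronglyMeasurable_fderiv_of_forall_apply`), so the Duhamel integral is
  `C¹` in `x` with derivative the integral of the derivatives;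
* `contDiff_succ_of_level` — **the upgrade**: every slice is `Cᵏ⁺¹` (the evaluated derivatives
  `x ↦ DᵏV(τ)(x)·m` are a smooth caloric term minus a `C¹` Duhamel term;
  `contDiff_succ_of_contDiff_one_iteratedFDeriv_apply`), with `‖Dᵏ⁺¹V(τ)‖ ≤ L` from the Lipschitz
  bound;
* `fderiv_levelIntegrand_apply` — derivatives fall on the (now `C¹`) level tensor:
  `∂ᵥ ∑ᵢ 𝒩_{τ−ρ}[Tₖᵐ(ρ)]ᵢ eᵢ = ∑ᵢ 𝒩_{τ−ρ}[Tₖ₊₁^{(v,m)}(ρ)]ᵢ eᵢ` (`fderiv_oseenHeat_apply_eq`,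
  `DifferentiableAt.iteratedFDeriv_succ_apply_left'`);
* `levelIdentity_succ`, `levelMeasurable_succ` — (iii)ₖ₊₁ (differentiate (iii)ₖ: the caloric
  term by `fderiv_heatExtension_apply_of_bounded`, the Duhamel term by the above) and (iv)ₖ₊₁;
* `level_all` — **the induction**: for all `k` there is `C = C(k, N, T, ·)` such that every `V`
  with `IsKNSSDriftMild T N V 0` carries the level-`k` data with bounds `C(δ)` on `[δ, T)`; in
  particular (`contDiff_slice`, `exists_norm_iteratedFDeriv_slice_le`) the slices are `C^∞` with
  `‖DᵏV(τ)(x)‖ ≤ C_k(δ)` on `[δ, T)` uniformly in `V` — KNSS's (4.10) for bounded mild solutions,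
  and the differentiated identities (iii)ₖ for all `k`, which the sequel uses for (4.11) and (4.8).

Everything is in the sub-namespace `KNSSBootstrap`.

## References

* G. Koch, N. Nadirashvili, G. Seregin, V. Šverák, *Liouville theorems for the Navier–Stokes
  equations and applications*, Acta Math. 203 (2009) 83–105 = arXiv:0709.3599v1, §4, Prop. 4.1,
  (4.5)–(4.6), (4.10). [KochNadirashviliSereginSverak2009]
* Y. Giga, K. Inui, S. Matsui, Quad. Mat. 4 (1999) 27–68, §3.
-/

noncomputable section

open MeasureTheory Set Function Filter TopologicalSpace InnerProductSpace Metric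
open _root_.Topology
open scoped RealInnerProductSpace NNReal ContDiff Interval

namespace Literature.Analysis.FluidPDE

namespace KNSSBootstrap

variable {E : Type*} [NormedAddCommGroup E] [InnerProductSpace ℝ E] [FiniteDimensional ℝ E]
  [MeasurableSpace E] [BorelSpace E]

/-! ### The level-`k` Duhamel integrand as a smooth map and its Lipschitz bound -/

section Integrand

variable (hE : Module.finrank ℝ E = 3)
include hE

variable {V : ℝ → E → E} {T δ₀ A L : ℝ} {k : ℕ}

/-- The level-`k` Duhamel integrand `x ↦ ∑ᵢ 𝒩_{τ−ρ}[Tₖᵐ(ρ)]ᵢ(x) eᵢ` is smooth in `x` for `ρ < τ`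
in the window (each `𝒩_{τ−ρ}[·]ᵢ` of bounded data is smooth, `contDiff_oseenHeat`). [folklore] -/
theorem contDiff_levelIntegrand (hA : 0 ≤ A) (hsm : ∀ τ ∈ Ioo 0 T, ContDiff ℝ k (V τ))
    (hbd : ∀ j ≤ k, ∀ τ ∈ Ico δ₀ T, ∀ x, ‖iteratedFDeriv ℝ j (V τ) x‖ ≤ A) (m : Fin k → E)
    {ρ τ : ℝ} (hδρ : δ₀ ≤ ρ) (h0ρ : 0 < ρ) (hρτ : ρ < τ) (hρT : ρ < T) {n : ℕ∞} :
    ContDiff ℝ n fun x => ∑ i, oseenHeat (τ - ρ)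
      (fun j l y => iteratedFDeriv ℝ k (driftTensor V 0 ρ j l) y m) i x • stdOrthonormalBasis ℝ E i := by
  have hW := hsm ρ ⟨h0ρ, hρT⟩
  have hbdρ : ∀ j ≤ k, ∀ y, ‖iteratedFDeriv ℝ j (V ρ) y‖ ≤ A := fun j hj y => hbd j hj ρ ⟨hδρ, hρT⟩ y
  simp only [driftTensor_zero_eq]
  refine ContDiff.sum fun i _ => ContDiff.smul ?_ contDiff_const
  exact contDiff_oseenHeat hE (fun j l => (memLp_top_levelTensor hW hA hbdρ j l m).1) (sub_pos.2 hρτ) i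

/-- **Lipschitz bound of the level-`k` Duhamel integrand**: if `DᵏV(ρ)` is `L`-Lipschitz then
`‖∑ᵢ(𝒩_{τ−ρ}[Tₖᵐ(ρ)]ᵢ(x + h) − 𝒩_{τ−ρ}[Tₖᵐ(ρ)]ᵢ(x))eᵢ‖ ≤ 8829(τ−ρ)^{-1/2}(2AL + 2ᵏ⁺¹A²)∏‖mᵢ‖ ‖h‖`,
hence the same bound for `‖D(∑ᵢ 𝒩_{τ−ρ}[Tₖᵐ(ρ)]ᵢ eᵢ)(x)‖`. [folklore] -/
theorem norm_fderiv_levelIntegrand_le (hA : 0 ≤ A) (hL : 0 ≤ L)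
    (hsm : ∀ τ ∈ Ioo 0 T, ContDiff ℝ k (V τ))
    (hbd : ∀ j ≤ k, ∀ τ ∈ Ico δ₀ T, ∀ x, ‖iteratedFDeriv ℝ j (V τ) x‖ ≤ A)
    (hlip : ∀ τ ∈ Ico δ₀ T, ∀ x h : E,
      ‖iteratedFDeriv ℝ k (V τ) (x + h) - iteratedFDeriv ℝ k (V τ) x‖ ≤ L * ‖h‖)
    (m : Fin k → E) {ρ τ : ℝ} (hδρ : δ₀ ≤ ρ) (h0ρ : 0 < ρ) (hρτ : ρ < τ) (hρT : ρ < T) (x : E) :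
    ‖fderiv ℝ (fun x => ∑ i, oseenHeat (τ - ρ)
        (fun j l y => iteratedFDeriv ℝ k (driftTensor V 0 ρ j l) y m) i x • stdOrthonormalBasis ℝ E i) x‖ ≤
      8829 * (τ - ρ) ^ (-(1 / 2 : ℝ)) * ((2 * A * L + 2 ^ (k + 1) * A ^ 2) * ∏ i, ‖m i‖) := by
  have hW := hsm ρ ⟨h0ρ, hρT⟩
  have hbdρ : ∀ j ≤ k, ∀ y, ‖iteratedFDeriv ℝ j (V ρ) y‖ ≤ A := fun j hj y => hbd j hj ρ ⟨hδρ, hρT⟩ y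
  set C : ℝ := 8829 * (τ - ρ) ^ (-(1 / 2 : ℝ)) * ((2 * A * L + 2 ^ (k + 1) * A ^ 2) * ∏ i, ‖m i‖)
    with hC
  have hC0 : 0 ≤ C := by
    have : 0 ≤ (τ - ρ) ^ (-(1 / 2 : ℝ)) := Real.rpow_nonneg (sub_pos.2 hρτ).le _
    positivity
  -- the integrand is `C`-Lipschitz
  have hlipG : ∀ y h : E, ‖(∑ i, oseenHeat (τ - ρ)
        (fun j l y => iteratedFDeriv ℝ k (driftTensor V 0 ρ j l) y m) i (y + h) •
          stdOrthonormalBasis ℝ E i) -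
        ∑ i, oseenHeat (τ - ρ) (fun j l y => iteratedFDeriv ℝ k (driftTensor V 0 ρ j l) y m) i y •
          stdOrthonormalBasis ℝ E i‖ ≤ C * ‖h‖ := by
    intro y h
    have hq : 0 ≤ L * ‖h‖ := mul_nonneg hL (norm_nonneg _)
    rw [← Finset.sum_sub_distrib]
    simp only [← sub_smul, driftTensor_zero_eq]
    refine (norm_sum_oseenHeat_levelTensor_add_sub_smul_le hE hW hA hbdρ hq h
      (fun z => hlip ρ ⟨hδρ, hρT⟩ z h) m (sub_pos.2 hρτ) y).trans (le_of_eq ?_)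
    simp only [hC]
    ring
  have hlw : LipschitzWith ⟨C, hC0⟩ (fun x => ∑ i, oseenHeat (τ - ρ)
      (fun j l y => iteratedFDeriv ℝ k (driftTensor V 0 ρ j l) y m) i x • stdOrthonormalBasis ℝ E i) := by
    refine LipschitzWith.of_dist_le_mul fun y z => ?_
    rw [dist_eq_norm, dist_eq_norm]
    have h := hlipG z (y - z)
    simp only [add_sub_cancel] at h
    exact h
  exact norm_fderiv_le_of_lipschitz ℝ hlw

/-- **Dominated differentiation of the level-`k` Duhamel integral.** Under the level-`k` data on
`(0, T)` with bounds `A` and the Lipschitz bound `L` for `DᵏV` on `[δ₀, T)`, for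
`δ₀ ≤ s₁`, `0 < s₁ < τ ≤ T` and every `k`-tuple `m`, the map
`x ↦ ∫_{s₁}^τ ∑ᵢ 𝒩_{τ−ρ}[Tₖᵐ(ρ)]ᵢ(x) eᵢ dρ` has at every `x₀` the Fréchet derivative
`∫_{s₁}^τ D(∑ᵢ 𝒩_{τ−ρ}[Tₖᵐ(ρ)]ᵢ eᵢ)(x₀) dρ`, this derivative is continuous in `x₀`, and the
derivative integrand is interval integrable (majorant `8829(τ−ρ)^{-1/2}(2AL + 2ᵏ⁺¹A²)∏‖mᵢ‖`;
measurability of `ρ ↦ D(…)(x₀)` from the point evaluations (iv)ₖ by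
`aestronglyMeasurable_fderiv_of_forall_apply`). [folklore] -/
theorem hasFDerivAt_levelDuhamel (hA : 0 ≤ A) (hL : 0 ≤ L)
    (hsm : ∀ τ ∈ Ioo 0 T, ContDiff ℝ k (V τ))
    (hbd : ∀ j ≤ k, ∀ τ ∈ Ico δ₀ T, ∀ x, ‖iteratedFDeriv ℝ j (V τ) x‖ ≤ A)
    (hlip : ∀ τ ∈ Ico δ₀ T, ∀ x h : E,
      ‖iteratedFDeriv ℝ k (V τ) (x + h) - iteratedFDeriv ℝ k (V τ) x‖ ≤ L * ‖h‖)
    (m : Fin k → E) {s₁ τ : ℝ} (hδs : δ₀ ≤ s₁) (h0s : 0 < s₁) (hsτ : s₁ < τ) (hτT : τ ≤ T)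
    (hms : ∀ (i : Fin (Module.finrank ℝ E)) (x : E), AEStronglyMeasurable
      (fun ρ => oseenHeat (τ - ρ) (fun j l y => iteratedFDeriv ℝ k (driftTensor V 0 ρ j l) y m) i x)
      (volume.restrict (Ioo 0 τ))) :
    (∀ x₀ : E, HasFDerivAt
        (fun x => ∫ ρ in s₁..τ, ∑ i, oseenHeat (τ - ρ)
          (fun j l y => iteratedFDeriv ℝ k (driftTensor V 0 ρ j l) y m) i x • stdOrthonormalBasis ℝ E i)
        (∫ ρ in s₁..τ, fderiv ℝ (fun x => ∑ i, oseenHeat (τ - ρ)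
          (fun j l y => iteratedFDeriv ℝ k (driftTensor V 0 ρ j l) y m) i x • stdOrthonormalBasis ℝ E i) x₀)
        x₀) ∧
    (Continuous fun x₀ : E => ∫ ρ in s₁..τ, fderiv ℝ (fun x => ∑ i, oseenHeat (τ - ρ)
        (fun j l y => iteratedFDeriv ℝ k (driftTensor V 0 ρ j l) y m) i x • stdOrthonormalBasis ℝ E i) x₀) ∧
    (∀ x₀ : E, IntervalIntegrable (fun ρ => fderiv ℝ (fun x => ∑ i, oseenHeat (τ - ρ)
        (fun j l y => iteratedFDeriv ℝ k (driftTensor V 0 ρ j l) y m) i x • stdOrthonormalBasis ℝ E i) x₀)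
        volume s₁ τ) := by
  -- notation
  set G : ℝ → E → E := fun ρ x => ∑ i, oseenHeat (τ - ρ)
    (fun j l y => iteratedFDeriv ℝ k (driftTensor V 0 ρ j l) y m) i x • stdOrthonormalBasis ℝ E i
    with hG
  set c : ℝ := (2 * A * L + 2 ^ (k + 1) * A ^ 2) * ∏ i, ‖m i‖ with hc
  set bnd : ℝ → ℝ := fun ρ => 8829 * (τ - ρ) ^ (-(1 / 2 : ℝ)) * c with hbnd
  have hbndi : IntervalIntegrable bnd volume s₁ τ :=
    ((intervalIntegrable_rpow_neg_half_sub_right s₁ τ τ).const_mul 8829).mul_const c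
  -- facts on the open interval
  have hIoo : ∀ ρ ∈ Ioo s₁ τ, δ₀ ≤ ρ ∧ 0 < ρ ∧ ρ < τ ∧ ρ < T := fun ρ hρ =>
    ⟨hδs.trans hρ.1.le, h0s.trans hρ.1, hρ.2, hρ.2.trans_le hτT⟩
  have hGsm : ∀ ρ ∈ Ioo s₁ τ, ContDiff ℝ 1 (G ρ) := fun ρ hρ => by
    obtain ⟨h1, h2, h3, h4⟩ := hIoo ρ hρ
    exact contDiff_levelIntegrand hE hA hsm hbd m h1 h2 h3 h4
  have hGfd : ∀ ρ ∈ Ioo s₁ τ, ∀ x, ‖fderiv ℝ (G ρ) x‖ ≤ bnd ρ := fun ρ hρ x => by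
    obtain ⟨h1, h2, h3, h4⟩ := hIoo ρ hρ
    exact norm_fderiv_levelIntegrand_le hE hA hL hsm hbd hlip m h1 h2 h3 h4 x
  -- measurability of the integrand on `Ι s₁ τ = Ioc s₁ τ`
  have hΙ : Ι s₁ τ = Ioc s₁ τ := uIoc_of_le hsτ.le
  have hrestr : (volume : Measure ℝ).restrict (Ι s₁ τ) = volume.restrict (Ioo s₁ τ) := by
    rw [hΙ]; exact (Measure.restrict_congr_set Ioo_ae_eq_Ioc).symm
  have hGmeas : ∀ x, AEStronglyMeasurable (fun ρ => G ρ x) (volume.restrict (Ι s₁ τ)) := by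
    intro x
    rw [hrestr]
    exact Finset.aestronglyMeasurable_fun_sum _ fun i _ =>
      ((hms i x).mono_measure (Measure.restrict_mono (Ioo_subset_Ioo_left h0s.le) le_rfl)).smul_const _
  have hGint : ∀ x, IntervalIntegrable (fun ρ => G ρ x) volume s₁ τ := fun x =>
    intervalIntegrable_levelIntegrand hE hA hsm hbd m hδs h0s hsτ.le hτT hms x
  -- measurability of the derivative integrand
  have hG'meas : ∀ x₀, AEStronglyMeasurable (fun ρ => fderiv ℝ (G ρ) x₀) (volume.restrict (Ι s₁ τ)) := by
    intro x₀
    refine aestronglyMeasurable_fderiv_of_forall_apply hGmeas ?_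
    rw [hrestr]
    refine (ae_restrict_iff' measurableSet_Ioo).2 (Eventually.of_forall fun ρ hρ => ?_)
    exact ((hGsm ρ hρ).differentiable one_ne_zero x₀)
  -- the a.e. hypotheses
  have hbound : ∀ x₀ : E, ∀ᵐ ρ ∂(volume : Measure ℝ), ρ ∈ Ι s₁ τ → ∀ x ∈ (univ : Set E),
      ‖fderiv ℝ (G ρ) x‖ ≤ bnd ρ := fun x₀ => by
    rw [hΙ]
    exact ae_mem_Ioc_of_forall_Ioo fun ρ hρ x _ => hGfd ρ hρ x
  have hdiff : ∀ᵐ ρ ∂(volume : Measure ℝ), ρ ∈ Ι s₁ τ → ∀ x ∈ (univ : Set E),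
      HasFDerivAt (G ρ) (fderiv ℝ (G ρ) x) x := by
    rw [hΙ]
    exact ae_mem_Ioc_of_forall_Ioo fun ρ hρ x _ =>
      (((hGsm ρ hρ).differentiable one_ne_zero) x).hasFDerivAt
  have hG'int : ∀ x₀, IntervalIntegrable (fun ρ => fderiv ℝ (G ρ) x₀) volume s₁ τ := by
    intro x₀
    rw [intervalIntegrable_iff_integrableOn_Ioc_of_le hsτ.le]
    have hm : AEStronglyMeasurable (fun ρ => fderiv ℝ (G ρ) x₀) (volume.restrict (Ioc s₁ τ)) := by
      rw [← hΙ]; exact hG'meas x₀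
    have hw : IntegrableOn bnd (Ioc s₁ τ) := (intervalIntegrable_iff_integrableOn_Ioc_of_le hsτ.le).1 hbndi
    refine Integrable.mono' hw hm ?_
    exact (ae_restrict_iff' measurableSet_Ioc).2
      (ae_mem_Ioc_of_forall_Ioo fun ρ hρ => hGfd ρ hρ x₀)
  refine ⟨fun x₀ => ?_, ?_, hG'int⟩
  · exact intervalIntegral.hasFDerivAt_integral_of_dominated_of_fderiv_le (μ := volume)
      (F := fun x ρ => G ρ x) (F' := fun x ρ => fderiv ℝ (G ρ) x) (bound := bnd) univ_mem
      (Eventually.of_forall hGmeas) (hGint x₀) (hG'meas x₀) (hbound x₀) hbndi hdiff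
  · refine intervalIntegral.continuous_of_dominated_interval (μ := volume)
      (F := fun x ρ => fderiv ℝ (G ρ) x) (bound := bnd) hG'meas (fun x₀ => ?_) hbndi ?_
    · rw [hΙ]
      exact ae_mem_Ioc_of_forall_Ioo fun ρ hρ => hGfd ρ hρ x₀
    · rw [hΙ]
      exact ae_mem_Ioc_of_forall_Ioo fun ρ hρ => (hGsm ρ hρ).continuous_fderiv one_ne_zero

end Integrand

/-! ### The upgrade `Cᵏ → Cᵏ⁺¹` -/

section Upgrade

variable (hE : Module.finrank ℝ E = 3)
include hE

variable {V : ℝ → E → E} {T : ℝ} {k : ℕ}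

/-- **The upgrade step.** Let `V` carry the level-`k` data on `(0, T)` — `Cᵏ` slices, bounds
`‖DʲV(τ)‖ ≤ C(δ)` for `j ≤ k` on `[δ, T)`, the differentiated identity (iii)ₖ and the
measurability (iv)ₖ — and the Lipschitz bound `‖DᵏV(τ)(x + h) − DᵏV(τ)(x)‖ ≤ L(δ)‖h‖` on
`[δ, T)` (the output of `lipschitz_iteratedFDeriv_of_level`). Then every slice `V(τ)`,
`0 < τ < T`, is `Cᵏ⁺¹`: by (iii)ₖ at `s₁ = τ/2`, each evaluated derivative `x ↦ DᵏV(τ)(x)·m` is a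
smooth caloric term minus a Duhamel integral which is `C¹` by `hasFDerivAt_levelDuhamel`, and a
`Cᵏ` map with `C¹` evaluated `k`-th derivatives is `Cᵏ⁺¹`
(`contDiff_succ_of_contDiff_one_iteratedFDeriv_apply`). [folklore] -/
theorem contDiff_succ_of_level {C L : ℝ → ℝ} (hC : ∀ δ, 0 < δ → 0 ≤ C δ) (hL : ∀ δ, 0 < δ → 0 ≤ L δ)
    (hsm : ∀ τ ∈ Ioo 0 T, ContDiff ℝ k (V τ))
    (hbd : ∀ δ, 0 < δ → ∀ j ≤ k, ∀ τ ∈ Ico δ T, ∀ x, ‖iteratedFDeriv ℝ j (V τ) x‖ ≤ C δ)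
    (hid : ∀ (m : Fin k → E) (s₁ τ : ℝ), 0 < s₁ → s₁ < τ → τ < T → ∀ x,
      iteratedFDeriv ℝ k (V τ) x m =
        UnboundedOperators.heatExtension (fun y => iteratedFDeriv ℝ k (V s₁) y m) (τ - s₁) x -
        ∫ σ in s₁..τ, ∑ i, oseenHeat (τ - σ)
          (fun j l y => iteratedFDeriv ℝ k (driftTensor V 0 σ j l) y m) i x • stdOrthonormalBasis ℝ E i)
    (hms : ∀ (m : Fin k → E) (τ : ℝ), τ ≤ T → ∀ (i : Fin (Module.finrank ℝ E)) (x : E),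
      AEStronglyMeasurable (fun σ => oseenHeat (τ - σ)
        (fun j l y => iteratedFDeriv ℝ k (driftTensor V 0 σ j l) y m) i x) (volume.restrict (Ioo 0 τ)))
    (hlip : ∀ δ, 0 < δ → ∀ τ ∈ Ico δ T, ∀ x h : E,
      ‖iteratedFDeriv ℝ k (V τ) (x + h) - iteratedFDeriv ℝ k (V τ) x‖ ≤ L δ * ‖h‖)
    {τ : ℝ} (hτ : τ ∈ Ioo 0 T) : ContDiff ℝ (k + 1) (V τ) := by
  refine contDiff_succ_of_contDiff_one_iteratedFDeriv_apply k (hsm τ hτ) fun m => ?_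
  -- the window `[τ/2, τ]`
  set s₁ : ℝ := τ / 2 with hs₁
  have hs₁0 : 0 < s₁ := half_pos hτ.1
  have hs₁τ : s₁ < τ := half_lt_self hτ.1
  have hs₁T : s₁ ∈ Ioo 0 T := ⟨hs₁0, hs₁τ.trans hτ.2⟩
  -- the caloric term is smooth
  set g : E → E := fun y => iteratedFDeriv ℝ k (V s₁) y m with hg
  set P : ℝ := ∏ i, ‖m i‖ with hP
  have hP0 : 0 ≤ P := Finset.prod_nonneg fun i _ => norm_nonneg _
  have hgc : Continuous g :=
    (ContinuousMultilinearMap.apply ℝ (fun _ : Fin k => E) E m).continuous.comp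
      ((hsm s₁ hs₁T).continuous_iteratedFDeriv le_rfl)
  have hgb : ∀ z, ‖g z‖ ≤ C s₁ * P := fun z =>
    (ContinuousMultilinearMap.le_opNorm _ _).trans
      (mul_le_mul_of_nonneg_right (hbd s₁ hs₁0 k le_rfl s₁ ⟨le_rfl, hs₁T.2⟩ z) hP0)
  have hHE : ContDiff ℝ 1 (UnboundedOperators.heatExtension g (τ - s₁)) :=
    UnboundedOperators.contDiff_heatExtension_of_bound hgc hgb (sub_pos.2 hs₁τ)
  -- the Duhamel term is `C¹`
  obtain ⟨hD, hDc, -⟩ := hasFDerivAt_levelDuhamel hE (hC s₁ hs₁0) (hL s₁ hs₁0) hsm (hbd s₁ hs₁0)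
    (hlip s₁ hs₁0) m le_rfl hs₁0 hs₁τ hτ.2.le (hms m τ hτ.2.le)
  have hDdiff : Differentiable ℝ fun x => ∫ ρ in s₁..τ, ∑ i, oseenHeat (τ - ρ)
      (fun j l y => iteratedFDeriv ℝ k (driftTensor V 0 ρ j l) y m) i x • stdOrthonormalBasis ℝ E i :=
    fun x => (hD x).differentiableAt
  have hDfd : (fderiv ℝ fun x => ∫ ρ in s₁..τ, ∑ i, oseenHeat (τ - ρ)
      (fun j l y => iteratedFDeriv ℝ k (driftTensor V 0 ρ j l) y m) i x • stdOrthonormalBasis ℝ E i) =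
      fun x₀ => ∫ ρ in s₁..τ, fderiv ℝ (fun x => ∑ i, oseenHeat (τ - ρ)
        (fun j l y => iteratedFDeriv ℝ k (driftTensor V 0 ρ j l) y m) i x • stdOrthonormalBasis ℝ E i) x₀ :=
    funext fun x => (hD x).fderiv
  have hD1 : ContDiff ℝ 1 fun x => ∫ ρ in s₁..τ, ∑ i, oseenHeat (τ - ρ)
      (fun j l y => iteratedFDeriv ℝ k (driftTensor V 0 ρ j l) y m) i x • stdOrthonormalBasis ℝ E i := by
    rw [contDiff_one_iff_fderiv]
    exact ⟨hDdiff, by rw [hDfd]; exact hDc⟩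
  -- the evaluated derivative is the difference
  have hfun : (fun x => iteratedFDeriv ℝ k (V τ) x m) = fun x =>
      UnboundedOperators.heatExtension g (τ - s₁) x -
      ∫ ρ in s₁..τ, ∑ i, oseenHeat (τ - ρ)
        (fun j l y => iteratedFDeriv ℝ k (driftTensor V 0 ρ j l) y m) i x • stdOrthonormalBasis ℝ E i :=
    funext fun x => hid m s₁ τ hs₁0 hs₁τ hτ.2 x
  rw [hfun]
  exact hHE.sub hD1

omit [FiniteDimensional ℝ E] [MeasurableSpace E] [BorelSpace E] hE in
/-- **The bound at order `k + 1`** from the Lipschitz bound at order `k`: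
`‖Dᵏ⁺¹V(τ)(x)‖ ≤ L(δ)` on `[δ, T)` (`norm_iteratedFDeriv_succ_le_of_lipschitz`). [folklore] -/
theorem norm_iteratedFDeriv_succ_le_of_level {L : ℝ → ℝ} (hL : ∀ δ, 0 < δ → 0 ≤ L δ)
    (hlip : ∀ δ, 0 < δ → ∀ τ ∈ Ico δ T, ∀ x h : E,
      ‖iteratedFDeriv ℝ k (V τ) (x + h) - iteratedFDeriv ℝ k (V τ) x‖ ≤ L δ * ‖h‖)
    {δ : ℝ} (hδ : 0 < δ) {τ : ℝ} (hτ : τ ∈ Ico δ T) (x : E) :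
    ‖iteratedFDeriv ℝ (k + 1) (V τ) x‖ ≤ L δ :=
  norm_iteratedFDeriv_succ_le_of_lipschitz (hL δ hδ) (hlip δ hδ τ hτ) x

end Upgrade

/-! ### Derivatives fall on the level tensor: the integrand at order `k + 1` -/

section Formula

variable (hE : Module.finrank ℝ E = 3)
include hE

variable {V : ℝ → E → E} {T δ₀ A : ℝ} {k : ℕ}

omit [MeasurableSpace E] [BorelSpace E] hE in
/-- The evaluated level tensor of a `Cᵏ⁺¹` slice is `C¹`, with derivative
`∂ᵥ(Dᵏ(WⱼWₗ)·m)(y) = Dᵏ⁺¹(WⱼWₗ)(y)(v, m)` and `‖D(Dᵏ(WⱼWₗ)·m)(y)‖ ≤ ‖evₘ‖ 2ᵏ⁺¹A²`. [folklore] -/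
theorem levelTensor_contDiff_one {W : E → E} (hW : ContDiff ℝ (k + 1) W) (hA : 0 ≤ A)
    (hbd : ∀ i ≤ k + 1, ∀ y, ‖iteratedFDeriv ℝ i W y‖ ≤ A) (j l : Fin (Module.finrank ℝ E))
    (m : Fin k → E) :
    ContDiff ℝ 1 (fun y => iteratedFDeriv ℝ k
        (fun y => ⟪W y, stdOrthonormalBasis ℝ E j⟫ * ⟪W y, stdOrthonormalBasis ℝ E l⟫) y m) ∧
    (∀ y v, fderiv ℝ (fun y => iteratedFDeriv ℝ k
        (fun y => ⟪W y, stdOrthonormalBasis ℝ E j⟫ * ⟪W y, stdOrthonormalBasis ℝ E l⟫) y m) y v =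
      iteratedFDeriv ℝ (k + 1)
        (fun y => ⟪W y, stdOrthonormalBasis ℝ E j⟫ * ⟪W y, stdOrthonormalBasis ℝ E l⟫) y (Fin.cons v m)) ∧
    (∀ y, ‖fderiv ℝ (fun y => iteratedFDeriv ℝ k
        (fun y => ⟪W y, stdOrthonormalBasis ℝ E j⟫ * ⟪W y, stdOrthonormalBasis ℝ E l⟫) y m) y‖ ≤
      ‖ContinuousMultilinearMap.apply ℝ (fun _ : Fin k => E) ℝ m‖ * (2 ^ (k + 1) * A ^ 2)) := by
  set P : E → ℝ := fun y => ⟪W y, stdOrthonormalBasis ℝ E j⟫ * ⟪W y, stdOrthonormalBasis ℝ E l⟫ with hP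
  have hPk : ContDiff ℝ (k + 1) P := contDiff_frameProduct hW j l
  have hDk : ContDiff ℝ 1 (iteratedFDeriv ℝ k P) :=
    hPk.iteratedFDeriv_right (m := 1) (i := k) (by rw [add_comm])
  have hd : ∀ y, DifferentiableAt ℝ (iteratedFDeriv ℝ k P) y := fun y =>
    (hPk.differentiable_iteratedFDeriv (by exact_mod_cast Nat.lt_succ_self k)) y
  set ev := ContinuousMultilinearMap.apply ℝ (fun _ : Fin k => E) ℝ m with hev
  have hcomp : (fun y => iteratedFDeriv ℝ k P y m) = fun y => ev (iteratedFDeriv ℝ k P y) := rfl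
  refine ⟨?_, fun y v => ((hd y).iteratedFDeriv_succ_apply_left' (m := Fin.cons v m)).symm,
    fun y => ?_⟩
  · rw [hcomp]; exact ev.contDiff.comp hDk
  · have h1 : HasFDerivAt (fun y => iteratedFDeriv ℝ k P y m) (ev.comp (fderiv ℝ (iteratedFDeriv ℝ k P) y)) y :=
      ev.hasFDerivAt.comp y (hd y).hasFDerivAt
    rw [h1.fderiv]
    refine (ContinuousLinearMap.opNorm_comp_le _ _).trans ?_
    rw [norm_fderiv_iteratedFDeriv]
    exact mul_le_mul_of_nonneg_left
      (norm_iteratedFDeriv_frameProduct_le hW le_rfl hA hbd j l le_rfl y) (norm_nonneg _)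

/-- **Derivatives fall on the level tensor** (one component): for a `Cᵏ⁺¹` slice `V(ρ)` with
bounds up to order `k + 1`,
`∂ᵥ 𝒩_{τ−ρ}[Tₖᵐ(ρ)]ᵢ(x) = 𝒩_{τ−ρ}[Tₖ₊₁^{(v,m)}(ρ)]ᵢ(x)` (`fderiv_oseenHeat_apply_eq`: the level
tensor is `C¹`, bounded, with bounded gradient). [folklore] -/
theorem fderiv_oseenHeat_levelTensor_apply (hA : 0 ≤ A)
    (hsm : ∀ τ ∈ Ioo 0 T, ContDiff ℝ (k + 1) (V τ))
    (hbd : ∀ j ≤ k + 1, ∀ τ ∈ Ico δ₀ T, ∀ x, ‖iteratedFDeriv ℝ j (V τ) x‖ ≤ A) (m : Fin k → E)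
    {ρ τ : ℝ} (hδρ : δ₀ ≤ ρ) (h0ρ : 0 < ρ) (hρτ : ρ < τ) (hρT : ρ < T)
    (i : Fin (Module.finrank ℝ E)) (x v : E) :
    fderiv ℝ (oseenHeat (τ - ρ) (fun j l y => iteratedFDeriv ℝ k (driftTensor V 0 ρ j l) y m) i) x v =
      oseenHeat (τ - ρ)
        (fun j l y => iteratedFDeriv ℝ (k + 1) (driftTensor V 0 ρ j l) y (Fin.cons v m)) i x := by
  have hW := hsm ρ ⟨h0ρ, hρT⟩
  have hbdρ : ∀ j ≤ k + 1, ∀ y, ‖iteratedFDeriv ℝ j (V ρ) y‖ ≤ A := fun j hj y => hbd j hj ρ ⟨hδρ, hρT⟩ y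
  have hWk : ContDiff ℝ k (V ρ) := hW.of_le (by exact_mod_cast Nat.le_succ k)
  have hbdk : ∀ j ≤ k, ∀ y, ‖iteratedFDeriv ℝ j (V ρ) y‖ ≤ A := fun j hj y => hbdρ j (hj.trans (Nat.le_succ k)) y
  simp only [driftTensor_zero_eq]
  have hreg := fun j l => levelTensor_contDiff_one hW hA hbdρ j l m
  rw [fderiv_oseenHeat_apply_eq hE (fun j l => (hreg j l).1)
    (fun j l => (memLp_top_levelTensor hWk hA hbdk j l m).1) (fun j l => ⟨_, (hreg j l).2.2⟩)
    (sub_pos.2 hρτ) i x v]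
  congr 1
  funext j l y
  exact (hreg j l).2.1 y v

/-- **Derivatives fall on the level tensor** (vector form): for a `Cᵏ⁺¹` slice,
`∂ᵥ ∑ᵢ 𝒩_{τ−ρ}[Tₖᵐ(ρ)]ᵢ(x) eᵢ = ∑ᵢ 𝒩_{τ−ρ}[Tₖ₊₁^{(v,m)}(ρ)]ᵢ(x) eᵢ`. [folklore] -/
theorem fderiv_levelIntegrand_apply (hA : 0 ≤ A)
    (hsm : ∀ τ ∈ Ioo 0 T, ContDiff ℝ (k + 1) (V τ))
    (hbd : ∀ j ≤ k + 1, ∀ τ ∈ Ico δ₀ T, ∀ x, ‖iteratedFDeriv ℝ j (V τ) x‖ ≤ A) (m : Fin k → E)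
    {ρ τ : ℝ} (hδρ : δ₀ ≤ ρ) (h0ρ : 0 < ρ) (hρτ : ρ < τ) (hρT : ρ < T) (x v : E) :
    fderiv ℝ (fun x => ∑ i, oseenHeat (τ - ρ)
        (fun j l y => iteratedFDeriv ℝ k (driftTensor V 0 ρ j l) y m) i x • stdOrthonormalBasis ℝ E i) x v =
      ∑ i, oseenHeat (τ - ρ)
        (fun j l y => iteratedFDeriv ℝ (k + 1) (driftTensor V 0 ρ j l) y (Fin.cons v m)) i x •
          stdOrthonormalBasis ℝ E i := by
  have hW := hsm ρ ⟨h0ρ, hρT⟩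
  have hWk : ContDiff ℝ k (V ρ) := hW.of_le (by exact_mod_cast Nat.le_succ k)
  have hbdk : ∀ j ≤ k, ∀ y, ‖iteratedFDeriv ℝ j (V ρ) y‖ ≤ A :=
    fun j hj y => hbd j (hj.trans (Nat.le_succ k)) ρ ⟨hδρ, hρT⟩ y
  have hdiff : ∀ i, DifferentiableAt ℝ
      (oseenHeat (τ - ρ) (fun j l y => iteratedFDeriv ℝ k (driftTensor V 0 ρ j l) y m) i) x := by
    intro i
    simp only [driftTensor_zero_eq]
    exact ((contDiff_oseenHeat hE (fun j l => (memLp_top_levelTensor hWk hA hbdk j l m).1)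
      (sub_pos.2 hρτ) i (n := 1)).differentiable one_ne_zero) x
  have hsum : HasFDerivAt (fun x => ∑ i, oseenHeat (τ - ρ)
      (fun j l y => iteratedFDeriv ℝ k (driftTensor V 0 ρ j l) y m) i x • stdOrthonormalBasis ℝ E i)
      (∑ i, (fderiv ℝ (oseenHeat (τ - ρ)
        (fun j l y => iteratedFDeriv ℝ k (driftTensor V 0 ρ j l) y m) i) x).smulRight
          (stdOrthonormalBasis ℝ E i)) x :=
    HasFDerivAt.fun_sum fun i _ => (hdiff i).hasFDerivAt.smul_const _
  rw [hsum.fderiv]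
  simp only [FunLike.coe_sum, Finset.sum_apply, ContinuousLinearMap.smulRight_apply]
  refine Finset.sum_congr rfl fun i _ => ?_
  rw [fderiv_oseenHeat_levelTensor_apply hE hA hsm hbd m hδρ h0ρ hρτ hρT i x v]

end Formula

/-! ### The differentiated identity and the measurability at order `k + 1` -/

section Succ

variable (hE : Module.finrank ℝ E = 3)
include hE

variable {V : ℝ → E → E} {T : ℝ} {k : ℕ}

omit [FiniteDimensional ℝ E] [MeasurableSpace E] [BorelSpace E] hE in
/-- Lipschitz bound of `DᵏV` from the bound on `Dᵏ⁺¹V` (mean value theorem). [folklore] -/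
theorem lipschitz_of_succ_bound {C : ℝ → ℝ}
    (hsm : ∀ τ ∈ Ioo 0 T, ContDiff ℝ (k + 1) (V τ))
    (hbd : ∀ δ, 0 < δ → ∀ j ≤ k + 1, ∀ τ ∈ Ico δ T, ∀ x, ‖iteratedFDeriv ℝ j (V τ) x‖ ≤ C δ)
    {δ : ℝ} (hδ : 0 < δ) :
    ∀ τ ∈ Ico δ T, ∀ x h : E,
      ‖iteratedFDeriv ℝ k (V τ) (x + h) - iteratedFDeriv ℝ k (V τ) x‖ ≤ C δ * ‖h‖ :=
  fun τ hτ x h => norm_iteratedFDeriv_add_sub_le (hsm τ ⟨hδ.trans_le hτ.1, hτ.2⟩)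
    (fun y => hbd δ hδ (k + 1) le_rfl τ hτ y) x h

omit [FiniteDimensional ℝ E] [MeasurableSpace E] [BorelSpace E] hE in
/-- The level-`k` bounds follow from the level-`(k+1)` bounds. [folklore] -/
theorem bound_of_succ_bound {C : ℝ → ℝ}
    (hbd : ∀ δ, 0 < δ → ∀ j ≤ k + 1, ∀ τ ∈ Ico δ T, ∀ x, ‖iteratedFDeriv ℝ j (V τ) x‖ ≤ C δ)
    {δ : ℝ} (hδ : 0 < δ) : ∀ j ≤ k, ∀ τ ∈ Ico δ T, ∀ x, ‖iteratedFDeriv ℝ j (V τ) x‖ ≤ C δ :=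
  fun j hj τ hτ x => hbd δ hδ j (hj.trans (Nat.le_succ k)) τ hτ x

/-- **The differentiated identity at order `k + 1`** from the level-`k` identity, for a field
whose slices are already `Cᵏ⁺¹` with bounds up to order `k + 1`: writing `m' = (v, m)`,
`Dᵏ⁺¹V(τ)(x)·m' = ∂ᵥ(DᵏV(τ)·m)(x)`; the caloric term differentiates to
`e^{(τ−s₁)Δ}[Dᵏ⁺¹V(s₁)·m']` (`fderiv_heatExtension_apply_of_bounded`), the Duhamel term to
`∫ ∑ᵢ 𝒩_{τ−σ}[Tₖ₊₁^{m'}(σ)]ᵢ eᵢ dσ` (`hasFDerivAt_levelDuhamel`, `fderiv_levelIntegrand_apply`).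
This is KNSS's "derivatives fall on the data" for the mild formula, one order at a time. [folklore] -/
theorem levelIdentity_succ {C : ℝ → ℝ} (hC : ∀ δ, 0 < δ → 0 ≤ C δ)
    (hsm : ∀ τ ∈ Ioo 0 T, ContDiff ℝ (k + 1) (V τ))
    (hbd : ∀ δ, 0 < δ → ∀ j ≤ k + 1, ∀ τ ∈ Ico δ T, ∀ x, ‖iteratedFDeriv ℝ j (V τ) x‖ ≤ C δ)
    (hid : ∀ (m : Fin k → E) (s₁ τ : ℝ), 0 < s₁ → s₁ < τ → τ < T → ∀ x,
      iteratedFDeriv ℝ k (V τ) x m =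
        UnboundedOperators.heatExtension (fun y => iteratedFDeriv ℝ k (V s₁) y m) (τ - s₁) x -
        ∫ σ in s₁..τ, ∑ i, oseenHeat (τ - σ)
          (fun j l y => iteratedFDeriv ℝ k (driftTensor V 0 σ j l) y m) i x • stdOrthonormalBasis ℝ E i)
    (hms : ∀ (m : Fin k → E) (τ : ℝ), τ ≤ T → ∀ (i : Fin (Module.finrank ℝ E)) (x : E),
      AEStronglyMeasurable (fun σ => oseenHeat (τ - σ)
        (fun j l y => iteratedFDeriv ℝ k (driftTensor V 0 σ j l) y m) i x) (volume.restrict (Ioo 0 τ)))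
    (m' : Fin (k + 1) → E) {s₁ τ : ℝ} (hs₁ : 0 < s₁) (hs₁τ : s₁ < τ) (hτT : τ < T) (x : E) :
    iteratedFDeriv ℝ (k + 1) (V τ) x m' =
      UnboundedOperators.heatExtension (fun y => iteratedFDeriv ℝ (k + 1) (V s₁) y m') (τ - s₁) x -
      ∫ σ in s₁..τ, ∑ i, oseenHeat (τ - σ)
        (fun j l y => iteratedFDeriv ℝ (k + 1) (driftTensor V 0 σ j l) y m') i x •
          stdOrthonormalBasis ℝ E i := by
  -- `m' = (v, m)`
  set v : E := m' 0 with hv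
  set m : Fin k → E := Fin.tail m' with hm
  have hm' : m' = Fin.cons v m := (Fin.cons_self_tail m').symm
  rw [hm']
  have hτ0 : τ ∈ Ioo 0 T := ⟨hs₁.trans hs₁τ, hτT⟩
  have hs₁T : s₁ ∈ Ioo 0 T := ⟨hs₁, hs₁τ.trans hτT⟩
  -- level-`k` data derived from the level-`(k+1)` data, window from `s₁`
  have hsmk : ∀ σ ∈ Ioo 0 T, ContDiff ℝ k (V σ) := fun σ hσ =>
    (hsm σ hσ).of_le (by exact_mod_cast Nat.le_succ k)
  have hA0 : 0 ≤ C s₁ := hC s₁ hs₁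
  have hbdk : ∀ j ≤ k, ∀ σ ∈ Ico s₁ T, ∀ y, ‖iteratedFDeriv ℝ j (V σ) y‖ ≤ C s₁ :=
    bound_of_succ_bound hbd hs₁
  have hlipk : ∀ σ ∈ Ico s₁ T, ∀ y h : E,
      ‖iteratedFDeriv ℝ k (V σ) (y + h) - iteratedFDeriv ℝ k (V σ) y‖ ≤ C s₁ * ‖h‖ :=
    lipschitz_of_succ_bound hsm hbd hs₁
  -- the left-hand side as a derivative of the evaluated `k`-th derivative
  have hdτ : DifferentiableAt ℝ (iteratedFDeriv ℝ k (V τ)) x :=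
    ((hsm τ hτ0).differentiable_iteratedFDeriv (by exact_mod_cast Nat.lt_succ_self k)) x
  rw [hdτ.iteratedFDeriv_succ_apply_left' (m := Fin.cons v m), Fin.cons_zero, Fin.tail_cons]
  -- the caloric datum `g = DᵏV(s₁)·m` and its derivative
  set g : E → E := fun y => iteratedFDeriv ℝ k (V s₁) y m with hg
  set P : ℝ := ∏ i, ‖m i‖ with hP
  have hP0 : 0 ≤ P := Finset.prod_nonneg fun i _ => norm_nonneg _
  have hds : ∀ y, DifferentiableAt ℝ (iteratedFDeriv ℝ k (V s₁)) y := fun y =>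
    ((hsm s₁ hs₁T).differentiable_iteratedFDeriv (by exact_mod_cast Nat.lt_succ_self k)) y
  set ev := ContinuousMultilinearMap.apply ℝ (fun _ : Fin k => E) E m with hev
  have hg1 : ContDiff ℝ 1 g := by
    have hDk : ContDiff ℝ 1 (iteratedFDeriv ℝ k (V s₁)) :=
      (hsm s₁ hs₁T).iteratedFDeriv_right (m := 1) (i := k) (by rw [add_comm])
    exact ev.contDiff.comp hDk
  have hg0 : ∀ z, ‖g z‖ ≤ C s₁ * P := fun z =>
    (ContinuousMultilinearMap.le_opNorm _ _).trans
      (mul_le_mul_of_nonneg_right (hbdk k le_rfl s₁ ⟨le_rfl, hs₁T.2⟩ z) hP0)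
  have hgv : ∀ z, fderiv ℝ g z v = iteratedFDeriv ℝ (k + 1) (V s₁) z (Fin.cons v m) := fun z =>
    ((hds z).iteratedFDeriv_succ_apply_left' (m := Fin.cons v m)).symm
  have hgv' : ∀ z, ‖fderiv ℝ g z v‖ ≤ C s₁ * ∏ i, ‖(Fin.cons v m : Fin (k + 1) → E) i‖ := fun z => by
    rw [hgv z]
    exact (ContinuousMultilinearMap.le_opNorm _ _).trans
      (mul_le_mul_of_nonneg_right (hbd s₁ hs₁ (k + 1) le_rfl s₁ ⟨le_rfl, hs₁T.2⟩ z)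
        (Finset.prod_nonneg fun i _ => norm_nonneg _))
  -- the Duhamel term and its derivative
  obtain ⟨hD, -, hD'int⟩ := hasFDerivAt_levelDuhamel hE hA0 hA0 hsmk hbdk hlipk m le_rfl hs₁ hs₁τ
    hτT.le (hms m τ hτT.le)
  -- the function identity (iii)ₖ on the window
  have hfun : (fun y => iteratedFDeriv ℝ k (V τ) y m) = fun y =>
      UnboundedOperators.heatExtension g (τ - s₁) y -
      ∫ ρ in s₁..τ, ∑ i, oseenHeat (τ - ρ)
        (fun j l y => iteratedFDeriv ℝ k (driftTensor V 0 ρ j l) y m) i y • stdOrthonormalBasis ℝ E i :=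
    funext fun y => hid m s₁ τ hs₁ hs₁τ hτT y
  have hHEd : DifferentiableAt ℝ (UnboundedOperators.heatExtension g (τ - s₁)) x :=
    ((UnboundedOperators.contDiff_heatExtension_of_bound hg1.continuous hg0 (sub_pos.2 hs₁τ)
      (m := 1)).differentiable one_ne_zero) x
  rw [hfun, fderiv_fun_sub hHEd (hD x).differentiableAt, sub_apply]
  congr 1
  · -- the caloric term: the derivative falls on the bounded `C¹` datum
    rw [UnboundedOperators.fderiv_heatExtension_apply_of_bounded hg1 hg0 hgv' (sub_pos.2 hs₁τ) x]
    congr 1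
    funext z
    exact hgv z
  · -- the Duhamel term: dominated differentiation, then derivatives fall on the level tensor
    rw [(hD x).fderiv, ContinuousLinearMap.intervalIntegral_apply (hD'int x) v]
    refine intervalIntegral.integral_congr_ae ?_
    rw [uIoc_of_le hs₁τ.le]
    exact ae_mem_Ioc_of_forall_Ioo fun ρ hρ =>
      fderiv_levelIntegrand_apply hE hA0 hsm (hbd s₁ hs₁) m hρ.1.le (hs₁.trans hρ.1) hρ.2
        (hρ.2.trans hτT) x v

/-- **The measurability datum at order `k + 1`**: for `m' = (v, m)` and `σ < τ ≤ T`,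
`𝒩_{τ−σ}[Tₖ₊₁^{m'}(σ)]ᵢ(x) = ∂ᵥ 𝒩_{τ−σ}[Tₖᵐ(σ)]ᵢ(x)` is the derivative in `x` of slices whose
point evaluations are measurable in `σ` by (iv)ₖ, hence measurable
(`aestronglyMeasurable_fderiv_of_forall_apply`). [folklore] -/
theorem levelMeasurable_succ {C : ℝ → ℝ} (hC : ∀ δ, 0 < δ → 0 ≤ C δ)
    (hsm : ∀ τ ∈ Ioo 0 T, ContDiff ℝ (k + 1) (V τ))
    (hbd : ∀ δ, 0 < δ → ∀ j ≤ k + 1, ∀ τ ∈ Ico δ T, ∀ x, ‖iteratedFDeriv ℝ j (V τ) x‖ ≤ C δ)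
    (hms : ∀ (m : Fin k → E) (τ : ℝ), τ ≤ T → ∀ (i : Fin (Module.finrank ℝ E)) (x : E),
      AEStronglyMeasurable (fun σ => oseenHeat (τ - σ)
        (fun j l y => iteratedFDeriv ℝ k (driftTensor V 0 σ j l) y m) i x) (volume.restrict (Ioo 0 τ)))
    (m' : Fin (k + 1) → E) {τ : ℝ} (hτT : τ ≤ T) (i : Fin (Module.finrank ℝ E)) (x : E) :
    AEStronglyMeasurable (fun σ => oseenHeat (τ - σ)
      (fun j l y => iteratedFDeriv ℝ (k + 1) (driftTensor V 0 σ j l) y m') i x)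
      (volume.restrict (Ioo 0 τ)) := by
  set v : E := m' 0 with hv
  set m : Fin k → E := Fin.tail m' with hm
  have hm' : m' = Fin.cons v m := (Fin.cons_self_tail m').symm
  rw [hm']
  -- the slices `x ↦ 𝒩_{τ−σ}[Tₖᵐ(σ)]ᵢ(x)` and their derivatives
  set g : ℝ → E → ℝ := fun σ x => oseenHeat (τ - σ)
    (fun j l y => iteratedFDeriv ℝ k (driftTensor V 0 σ j l) y m) i x with hg
  have hmeas : ∀ x, AEStronglyMeasurable (fun σ => g σ x) (volume.restrict (Ioo 0 τ)) :=
    fun x => hms m τ hτT i x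
  have hdiff : ∀ᵐ σ ∂(volume.restrict (Ioo 0 τ)), DifferentiableAt ℝ (g σ) x := by
    refine (ae_restrict_iff' measurableSet_Ioo).2 (Eventually.of_forall fun σ hσ => ?_)
    have hσT : σ ∈ Ioo 0 T := ⟨hσ.1, hσ.2.trans_le hτT⟩
    have hW : ContDiff ℝ k (V σ) := (hsm σ hσT).of_le (by exact_mod_cast Nat.le_succ k)
    have hA : 0 ≤ max (C σ) 0 := le_max_right _ _
    have hbdσ : ∀ j ≤ k, ∀ y, ‖iteratedFDeriv ℝ j (V σ) y‖ ≤ max (C σ) 0 := fun j hj y =>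
      (hbd σ hσ.1 j (hj.trans (Nat.le_succ k)) σ ⟨le_rfl, hσT.2⟩ y).trans (le_max_left _ _)
    simp only [hg, driftTensor_zero_eq]
    exact ((contDiff_oseenHeat hE (fun j l => (memLp_top_levelTensor hW hA hbdσ j l m).1)
      (sub_pos.2 hσ.2) i (n := 1)).differentiable one_ne_zero) x
  have hfd : AEStronglyMeasurable (fun σ => fderiv ℝ (g σ) x v) (volume.restrict (Ioo 0 τ)) :=
    (ContinuousLinearMap.apply ℝ ℝ v).continuous.comp_aestronglyMeasurable
      (aestronglyMeasurable_fderiv_of_forall_apply hmeas hdiff)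
  refine hfd.congr ((ae_restrict_iff' measurableSet_Ioo).2 (Eventually.of_forall fun σ hσ => ?_))
  have hσT : σ ∈ Ioo 0 T := ⟨hσ.1, hσ.2.trans_le hτT⟩
  simp only [hg]
  exact fderiv_oseenHeat_levelTensor_apply hE (hC σ hσ.1) hsm (hbd σ hσ.1) m le_rfl hσ.1 hσ.2 hσT.2
    i x v

end Succ

/-! ### The induction over the order -/

section Induction

variable (hE : Module.finrank ℝ E = 3)
include hE

/-- **All levels of the bootstrap** (KNSS 2009, Prop. 4.1 with (4.6) / (4.10) for bounded mild
solutions, in the tree's rendering). For every order `k` there is a function `C = C_k(δ)`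
(depending on `k`, `N`, `T` only) such that every field `V` with `IsKNSSDriftMild T N V 0` —
a bounded solution of the mild Navier–Stokes equation on `(0, T) × ℝ³` in the heat-flow Oseen
form — has `Cᵏ` slices with `‖DʲV(τ)(x)‖ ≤ C_k(δ)` for `j ≤ k`, `τ ∈ [δ, T)`, and satisfies
the `k`-times differentiated mild identity (iii)ₖ and the measurability (iv)ₖ. Induction on
`k`: level `0` is the drift-mild structure itself; the step is the Lipschitz estimate
(`lipschitz_iteratedFDeriv_of_level`, singular Gronwall on first differences), the upgrade
(`contDiff_succ_of_level`) and the differentiation of the identity (`levelIdentity_succ`,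
`levelMeasurable_succ`); the new constant is `max(C_k(δ), L_k(δ))` with `L_k(δ)` the Lipschitz
constant produced from the bound `max(C_k(δ/2), 1)`. [cite: KochNadirashviliSereginSverak2009, Prop. 4.1 with (4.5)–(4.6), (4.10) (arXiv:0709.3599v1 p. 8)] -/
theorem level_all {T N : ℝ} (k : ℕ) :
    ∃ C : ℝ → ℝ, (∀ δ, 0 < δ → 0 ≤ C δ) ∧ ∀ ⦃V : ℝ → E → E⦄, IsKNSSDriftMild T N V 0 →
      (∀ τ ∈ Ioo 0 T, ContDiff ℝ k (V τ)) ∧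
      (∀ δ, 0 < δ → ∀ j ≤ k, ∀ τ ∈ Ico δ T, ∀ x, ‖iteratedFDeriv ℝ j (V τ) x‖ ≤ C δ) ∧
      (∀ (m : Fin k → E) (s₁ τ : ℝ), 0 < s₁ → s₁ < τ → τ < T → ∀ x,
        iteratedFDeriv ℝ k (V τ) x m =
          UnboundedOperators.heatExtension (fun y => iteratedFDeriv ℝ k (V s₁) y m) (τ - s₁) x -
          ∫ σ in s₁..τ, ∑ i, oseenHeat (τ - σ)
            (fun j l y => iteratedFDeriv ℝ k (driftTensor V 0 σ j l) y m) i x •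
              stdOrthonormalBasis ℝ E i) ∧
      (∀ (m : Fin k → E) (τ : ℝ), τ ≤ T → ∀ (i : Fin (Module.finrank ℝ E)) (x : E),
        AEStronglyMeasurable (fun σ => oseenHeat (τ - σ)
          (fun j l y => iteratedFDeriv ℝ k (driftTensor V 0 σ j l) y m) i x)
          (volume.restrict (Ioo 0 τ))) := by
  induction k with
  | zero =>
    refine ⟨fun _ => max N 0, fun _ _ => le_max_right _ _, fun V hV => ⟨?_, ?_, ?_, ?_⟩⟩
    · exact fun τ hτ => levelZero_contDiff hE hV hτ
    · exact fun δ hδ j hj τ hτ x => (levelZero_bound hV hδ j hj τ hτ x).trans (le_max_left _ _)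
    · exact fun m s₁ τ hs₁ hs₁τ hτ x => levelZero_identity hV m hs₁ hs₁τ hτ x
    · exact fun m τ hτ i x => levelZero_measurable hE hV m hτ i x
  | succ k ih =>
    obtain ⟨C, hC0, hCV⟩ := ih
    -- the Lipschitz constants, level by level in `δ`
    have hA : ∀ δ, 1 ≤ max (C (δ / 2)) 1 := fun δ => le_max_right _ _
    set L : ℝ → ℝ := fun δ => if h : 0 < δ then
      Classical.choose (lipschitz_iteratedFDeriv_of_level hE (T := T) k (hA δ) h) else 0 with hL
    have hL0 : ∀ δ, 0 < δ → 0 ≤ L δ := fun δ hδ => by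
      simp only [hL, dif_pos hδ]
      exact (Classical.choose_spec (lipschitz_iteratedFDeriv_of_level hE (T := T) k (hA δ) hδ)).1
    have hLspec : ∀ δ (hδ : 0 < δ) ⦃V : ℝ → E → E⦄, IsKNSSDriftMild T N V 0 →
        ∀ τ ∈ Ico δ T, ∀ x h : E,
          ‖iteratedFDeriv ℝ k (V τ) (x + h) - iteratedFDeriv ℝ k (V τ) x‖ ≤ L δ * ‖h‖ := by
      intro δ hδ V hV
      obtain ⟨hsm, hbd, hid, hms⟩ := hCV hV
      have hspec := (Classical.choose_spec (lipschitz_iteratedFDeriv_of_level hE (T := T) k (hA δ) hδ)).2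
      have hbdA : ∀ j ≤ k, ∀ τ ∈ Ico (δ / 2) T, ∀ x, ‖iteratedFDeriv ℝ j (V τ) x‖ ≤ max (C (δ / 2)) 1 :=
        fun j hj τ hτ x => (hbd (δ / 2) (half_pos hδ) j hj τ hτ x).trans (le_max_left _ _)
      have h := hspec hsm hbdA hid hms
      simp only [hL, dif_pos hδ]
      exact h
    refine ⟨fun δ => max (C δ) (L δ), fun δ hδ => (hC0 δ hδ).trans (le_max_left _ _), fun V hV => ?_⟩
    obtain ⟨hsm, hbd, hid, hms⟩ := hCV hV
    have hlip : ∀ δ, 0 < δ → ∀ τ ∈ Ico δ T, ∀ x h : E,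
        ‖iteratedFDeriv ℝ k (V τ) (x + h) - iteratedFDeriv ℝ k (V τ) x‖ ≤ L δ * ‖h‖ :=
      fun δ hδ => hLspec δ hδ hV
    -- (i) the upgrade
    have hsm1 : ∀ τ ∈ Ioo 0 T, ContDiff ℝ (k + 1) (V τ) := fun τ hτ =>
      contDiff_succ_of_level hE hC0 hL0 hsm hbd hid hms hlip hτ
    -- (ii) the bounds
    have hbd1 : ∀ δ, 0 < δ → ∀ j ≤ k + 1, ∀ τ ∈ Ico δ T, ∀ x,
        ‖iteratedFDeriv ℝ j (V τ) x‖ ≤ max (C δ) (L δ) := by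
      intro δ hδ j hj τ hτ x
      rcases Nat.lt_succ_iff_lt_or_eq.1 (Nat.lt_succ_iff.2 hj) with hj' | hj'
      · exact (hbd δ hδ j (Nat.lt_succ_iff.1 hj') τ hτ x).trans (le_max_left _ _)
      · rw [hj']
        exact (norm_iteratedFDeriv_succ_le_of_level hL0 hlip hδ hτ x).trans (le_max_right _ _)
    have hC10 : ∀ δ, 0 < δ → 0 ≤ max (C δ) (L δ) := fun δ hδ => (hC0 δ hδ).trans (le_max_left _ _)
    refine ⟨by exact_mod_cast hsm1, hbd1, ?_, ?_⟩
    · exact fun m s₁ τ hs₁ hs₁τ hτ x =>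
        levelIdentity_succ hE hC10 hsm1 hbd1 hid hms m hs₁ hs₁τ hτ x
    · exact fun m τ hτ i x => levelMeasurable_succ hE hC10 hsm1 hbd1 hms m hτ i x

/-- **Smoothness of the slices** (KNSS Prop. 4.1, qualitative part): every slice `V(τ)`,
`0 < τ < T`, of a bounded mild solution is `C^∞`. [cite: KochNadirashviliSereginSverak2009, Prop. 4.1 (arXiv:0709.3599v1 p. 8)] -/
theorem contDiff_slice {T N : ℝ} {V : ℝ → E → E} (hV : IsKNSSDriftMild T N V 0) {τ : ℝ}
    (hτ : τ ∈ Ioo 0 T) : ContDiff ℝ ∞ (V τ) := by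
  refine contDiff_infty.2 fun k => ?_
  obtain ⟨C, -, hCV⟩ := level_all hE (T := T) (N := N) k
  exact (hCV hV).1 τ hτ

/-- **The uniform bounds (4.10) for bounded mild solutions**: for every order `k` there is
`C_k(δ)` (depending on `k, N, T` only) with `‖DᵏV(τ)(x)‖ ≤ C_k(δ)` for all `τ ∈ [δ, T)`, all
`x`, and all `V` with `IsKNSSDriftMild T N V 0`. [cite: KochNadirashviliSereginSverak2009, §4 (4.10) with Prop. 4.1 (4.6) (arXiv:0709.3599v1 p. 8)] -/
theorem exists_norm_iteratedFDeriv_slice_le {T N : ℝ} (k : ℕ) :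
    ∃ C : ℝ → ℝ, ∀ ⦃V : ℝ → E → E⦄, IsKNSSDriftMild T N V 0 →
      ∀ δ, 0 < δ → ∀ τ ∈ Ico δ T, ∀ x, ‖iteratedFDeriv ℝ k (V τ) x‖ ≤ C δ := by
  obtain ⟨C, -, hCV⟩ := level_all hE (T := T) (N := N) k
  exact ⟨C, fun V hV δ hδ τ hτ x => (hCV hV).2.1 δ hδ k le_rfl τ hτ x⟩

end Induction


end KNSSBootstrap

end Literature.Analysis.FluidPDE

end
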